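import Mathlib

/-!
# Crux `ClassTransfer` (stmt-ValiantsHypothesis-7287), negative side — tools:
# a Gram identity keyed by an arbitrary map, and transversals of `t`-subsets of `Fin m`

Lead prover (gen 1) of line `registered`.  Two pure-Mathlib tools for the flattening lower bound
of `Negative/Fermionant.lean` (any commutative realisation of `σ ↦ k^{c(σ)}` on `S_{4t}` has
dimension `≥ C(2t, t)`):

* `sum_conj_mul_indicator_key` — the GRAM IDENTITY for the kernel "same key":
  `Σ_a Σ_b conj(w a) [key a = key b] w b = Σ_c |Σ_{key a = c} w a|²` for any map `key : ι → κ`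
  (generalises `sum_conj_mul_indicator_agree` of `Negative/FlatteningKernel.lean`, whose key is
  the restriction pattern to a subset);
* `exists_perm_mem_iff_lt` — for a `t`-subset `S ⊆ Fin m` there is a permutation of `Fin m`
  carrying `S` exactly onto the first `t` points (extend the rank map `S ≃o Fin t` by
  `Finset.exists_equiv_extend_of_card_eq`).

No definitions. [folklore]
-/

set_option linter.dupNamespace false

noncomputable section

namespace Summit.ValiantsHypothesis.ValiantsHypothesis.Theorems.ClassTransfer.Negative

open Equiv Finset

/-- **Gram identity** for the kernel "same key": `Σ_a Σ_b conj(w a) [key a = key b] w b =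
Σ_c |Σ_{key a = c} w a|²`. [folklore] -/
theorem sum_conj_mul_indicator_key {ι κ : Type*} [Fintype ι] [Fintype κ] [DecidableEq κ]
    (key : ι → κ) (w : ι → ℂ) :
    ∑ a, ∑ b, (starRingEnd ℂ) (w a) * (if key a = key b then 1 else 0) * w b =
      ∑ c : κ, (starRingEnd ℂ) (∑ a ∈ univ.filter (fun a => key a = c), w a) *
        (∑ a ∈ univ.filter (fun a => key a = c), w a) := by
  classical
  set T : κ → ℂ := fun c => ∑ a ∈ univ.filter (fun a => key a = c), w a with hT
  have hinner : ∀ a : ι,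
      ∑ b, (starRingEnd ℂ) (w a) * (if key a = key b then 1 else 0) * w b =
        (starRingEnd ℂ) (w a) * T (key a) := by
    intro a
    simp_rw [mul_assoc]
    rw [← Finset.mul_sum]
    congr 1
    show _ = ∑ b ∈ univ.filter (fun b => key b = key a), w b
    rw [Finset.sum_filter]
    refine Finset.sum_congr rfl fun b _ => ?_
    rw [boole_mul]
    exact if_congr eq_comm rfl rfl
  rw [Finset.sum_congr rfl fun a _ => hinner a,
    ← Finset.sum_fiberwise univ key (fun a => (starRingEnd ℂ) (w a) * T (key a))]
  refine Finset.sum_congr rfl fun c _ => ?_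
  have hfib : ∑ a ∈ univ.filter (fun a => key a = c), (starRingEnd ℂ) (w a) * T (key a) =
      ∑ a ∈ univ.filter (fun a => key a = c), (starRingEnd ℂ) (w a) * T c := by
    refine Finset.sum_congr rfl fun a ha => ?_
    rw [(Finset.mem_filter.1 ha).2]
  rw [hfib, ← Finset.sum_mul, ← map_sum]

/-- For a `t`-subset `S` of `Fin m` there is a permutation of `Fin m` carrying `S` exactly onto
the first `t` points. [folklore] -/
theorem exists_perm_mem_iff_lt {m t : ℕ} (S : Finset (Fin m)) (hS : S.card = t) :
    ∃ π : Perm (Fin m), ∀ i : Fin m, i ∈ S ↔ ((π i : Fin m) : ℕ) < t := by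
  classical
  have htm : t ≤ m := by
    have := S.card_le_univ
    rwa [Fintype.card_fin, hS] at this
  -- the rank map on `S`, extended arbitrarily
  set f : Fin m → Fin m := fun i =>
    if h : i ∈ S then ⟨(((S.orderIsoOfFin hS).symm ⟨i, h⟩ : Fin t) : ℕ), by omega⟩ else i with hf
  have hfS : ∀ (i : Fin m) (h : i ∈ S),
      ((f i : Fin m) : ℕ) = (((S.orderIsoOfFin hS).symm ⟨i, h⟩ : Fin t) : ℕ) := by
    intro i h
    simp [hf, h]
  have hinj : Set.InjOn f (S : Set (Fin m)) := by
    intro i hi j hj hij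
    have hi' : i ∈ S := Finset.mem_coe.1 hi
    have hj' : j ∈ S := Finset.mem_coe.1 hj
    have hval : (((S.orderIsoOfFin hS).symm ⟨i, hi'⟩ : Fin t) : ℕ) =
        (((S.orderIsoOfFin hS).symm ⟨j, hj'⟩ : Fin t) : ℕ) := by
      rw [← hfS i hi', ← hfS j hj', hij]
    have h2 : (S.orderIsoOfFin hS).symm ⟨i, hi'⟩ = (S.orderIsoOfFin hS).symm ⟨j, hj'⟩ :=
      Fin.ext hval
    have h3 := (S.orderIsoOfFin hS).symm.injective h2
    exact congrArg Subtype.val h3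
  obtain ⟨g, hg⟩ := Finset.exists_equiv_extend_of_card_eq (α := Fin m)
    (t := (univ : Finset (Fin m))) (by simp) (s := S) (f := f)
    (fun x _ => Finset.mem_univ _) hinj
  refine ⟨g.trans (Equiv.subtypeUnivEquiv Finset.mem_univ), fun i => ?_⟩
  have hπ : ∀ j : Fin m, ((g.trans (Equiv.subtypeUnivEquiv Finset.mem_univ)) j : Fin m) =
      (g j : Fin m) := fun j => rfl
  constructor
  · intro hi
    rw [hπ, hg i hi, hfS i hi]
    exact Fin.is_lt _
  · intro hlt
    by_contra hi
    -- the point of `S` of rank `π i` is also sent to `π i`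
    set r : Fin t := ⟨_, hlt⟩ with hr
    set j : Fin m := ((S.orderIsoOfFin hS) r : Fin m) with hj
    have hjS : j ∈ S := ((S.orderIsoOfFin hS) r).2
    have hgj : ((g j : Fin m) : ℕ) = (((g.trans (Equiv.subtypeUnivEquiv Finset.mem_univ)) i :
        Fin m) : ℕ) := by
      rw [hg j hjS, hfS j hjS]
      have : (S.orderIsoOfFin hS).symm ⟨j, hjS⟩ = r := (OrderIso.symm_apply_eq _).2 rfl
      rw [this]
    have hji : j = i := by
      have h1 : g j = g i := Subtype.ext (Fin.ext (by rw [hgj]; rfl))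
      exact g.injective h1
    exact hi (hji ▸ hjS)

end Summit.ValiantsHypothesis.ValiantsHypothesis.Theorems.ClassTransfer.Negative
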